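import Literature.Analysis.Complex.SchwarzPickNearBoundary
import Summits.QuantumFields.BalabanUV.T4Continuum.Support.NE9EllInftyHolomorphy

/-!
# NE9PolydiscSchwarzPick — ROUTE R4♯ «POLYDISC SCHWARZ–PICK», PART 1∕3: coordinates of `ℓ^∞(A;ℂ)`, the Möbius disc
# through a point of its unit ball, and the INFINITESIMAL POLYDISC SCHWARZ–PICK LEMMA `norm_fderiv_apply_le`
# (the planner kernel `t4/ideate/NE9/lens1-NE9PolydiscKernel.lean` sha16 a147eb83d7390d11, t4-ne9-idea-1 generation 5,
# §§1–4, proofs VERBATIM — filed under the planner's OFFER (a) «→ leaf-03 (chain holder p252549)» of `t4/ROUTES-NE9.md` v5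
# §V5; cell `pub-balaban`, T4-DAG §2 node U3 ∕ §6 NE9; unit `b2b-balaban-t4-ne9-formalise-leaf-03`, generation 41;
# Summits-side generic several-complex-variables work on the tree's `pack` (p252722); nothing of any import modified,
# nothing printed asserted, no named fact, 0 `def … : Prop`; data defs = the kernel's `discFam`, `disc` — its `coord` is
# replaced by Mathlib's `lp.evalCLM`, author's note (n1))

HONEST FRAMING (T4-DAG PAGE 1).  Rung (B)+1 of the FINITE-VOLUME T⁴ programme — NOT infinite volume, NOT a mass gap, NOT
the Clay problem.  NE9 (`T4OutputRate.NE9` ∧ `FadingMemory`) is a cell NEW ESTIMATE, NOT PRINTED in [I] = CMP **109**, [II] =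
CMP **116**, and NOT PROVED here or anywhere (spine PROVED 0∕9).  This file contains NO NE9 statement at all: it is the
one-variable-to-polydisc transfer that PART 2 (`NE9PolydiscChain`) turns into route R4's chain estimate at the sharp rate `θ`.
HONEST DEPENDENCY (cell line, verbatim): continuum YM on T⁴ ⇐ BetaPertH ∧ nine spine estimates (0/9 proved); BetaPertH ⇐
(D1) ∧ (D4) ∧ CAP+tail; G-an2-4 gates asym, D1 and NE2/3/4.  Nothing of Bałaban's is constructed here.

THE POINT (planner's paragraph, abridged).  Route R4's kernel (tree: `EarleHamilton.norm_sub_le_of_holoChain`,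
`NE9EarleHamiltonChain.chainLipschitz_of_holoSelfMaps`, p251741 ∕ p252549) contracts the Carathéodory–Reiffen seminorm of an
ARBITRARY complex Banach space by the Earle–Hamilton ∕ Harris factor `2θ∕(1+θ)`.  But R4's state space is (isometric to) an
`ℓ^∞(A;ℂ)` — all SUP norms of scalar complex coordinates — whose unit ball is an infinite POLYDISC; there the invariant
infinitesimal metric is the supremum of the coordinate Poincaré metrics and a holomorphic map `B(0,1) → B̄(0,θ)` contracts
`P(x;v) = sup_α |v_α| ∕ (1 − |x_α|²)` by the factor `θ` itself (attained by `θ·id`).  This file proves exactly the inequality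
used (§4), not the metric theory.

WHAT (all kernel-checked, 0 sorry; the planner's §-numbers kept).
* §1 coordinates of `ℓ^∞(A;ℂ)`, `A` ARBITRARY: `evalCLM_apply` (Mathlib's `lp.evalCLM ℂ _ ∞ β` evaluates — no new
  evaluation `def` is introduced), `norm_coordFn_le`.
* §2 `hasDerivAt_moebius` — derivative `(1−c̄c)∕(1−c̄v)²` of the disc automorphism `M_c` of
  `Literature.Analysis.Complex.SchwarzPickNearBoundary`; `norm_moebius_le_sharp` — `|c| ≤ s < 1, |v| ≤ t < 1 ⇒ |M_c v| ≤
  1 − (1−s²)(1−t²)∕8`.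
* §3 THE MÖBIUS DISC `disc x lam : ℂ → ℓ^∞(A;ℂ)` through `x ∈ B(0,1)` with direction data `|lam α| ≤ 1`
  (`z ↦ (M_{−x_α}(λ_α z))_α`, packed by the tree's `NE9EllInftyHolomorphy.pack`): holomorphic on the unit disc
  (`differentiableOn_disc`), into the OPEN unit ball (`mapsTo_disc`), `disc 0 = x` (`disc_zero`), velocity
  `(D disc(0)·1)_α = (1 − |x_α|²)·λ_α` (`fderiv_disc_zero_apply`).
* §4 **`norm_fderiv_apply_le`** — THE INFINITESIMAL POLYDISC SCHWARZ–PICK LEMMA: `f : B_{ℓ^∞(A)}(0,1) → B̄_𝔉(0,θ)` holomorphic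
  into any complex normed `𝔉`, `π : 𝔉 →L[ℂ] ℂ` with `‖π y‖ ≤ ‖y‖`, `0 ≤ θ < θ' ≤ 1`, `x ∈ B(0,1)`, `|v_α| ≤ C·(1 − |x_α|²) ∀α`
  ⇒ `|π(Df(x)v)| ≤ θ'·C·(1 − |π(f x)|²)` (Möbius disc in the source, `M_c` with `c = π(f x)∕θ'` in the target, Mathlib's
  Schwarz lemma `Complex.norm_deriv_le_div_of_mapsTo_ball` in between).
DISGUISE TEST: no inequality of the series; no NE9 object; no Bałaban object; 0 sorry; no named fact; nothing printed asserted.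
PLACEMENT: Summits∕Support (our generic work on a Summits-side import), not Literature∕ — the statement for `ℓ^∞(A)` with `A`
infinite is several-complex-variables folklore (product property of the Carathéodory∕Kobayashi metric on polydiscs +
one-variable Schwarz–Pick), found in print for finite polydiscs; the loci below are TYPES ∕ pointers only.

References: [FV1980] T. Franzoni, E. Vesentini, *Holomorphic maps and invariant distances*, North-Holland Math. Studies 40
(1980), ch. V §5 ((V.5.1), Thm V.5.2); [Kobayashi2005] S. Kobayashi, *Hyperbolic Manifolds and Holomorphic Mappings* (2nd
ed., 2005), ch. IV Example 1 (product property `c_{D^k} = max c_D`); [Harris1979] L. A. Harris, Schwarz–Pick systems of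
pseudometrics …, North-Holland Math. Studies 34 (1979) 345–406; [JarnickiPflug1993] M. Jarnicki, P. Pflug, *Invariant
Distances and Metrics in Complex Analysis* (1993), ch. 3.  TYPES ∕ loci only; nothing asserted.
-/

noncomputable section

namespace Summit.QuantumFields.BalabanUV.T4Continuum.NE9PolydiscSchwarzPick

open Metric Set Filter
open scoped Topology ComplexConjugate ENNReal
open Literature.Analysis.Complex.SchwarzPick (moebius normSq_identity denom_ne_zero norm_moebius_le moebius_self
  differentiableOn_moebius)
open Summit.QuantumFields.BalabanUV.T4Continuum.NE9EllInftyHolomorphy (pack pack_apply_of_bound norm_pack_le_of_bound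
  hasFDerivAt_pack packDeriv_apply differentiableOn_pack)

variable {A : Type*}

/-! ## §1 Coordinates of `ℓ^∞(A;ℂ)` (the evaluation functional itself is Mathlib's `lp.evalCLM ℂ (fun _ : A => ℂ) ∞ β`) -/

/-- Mathlib's coordinate evaluation CLM on `ℓ^∞(A;ℂ)` evaluates: `lp.evalCLM ℂ _ ∞ β x = x β` (the planner kernel's `coord`,
replaced by the Mathlib object per the author's note (n1)). [folklore] -/
@[simp] theorem evalCLM_apply (β : A) (x : lp (fun _ : A => ℂ) ∞) : lp.evalCLM ℂ (fun _ : A => ℂ) ∞ β x = x β := rfl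

/-- `|x_β| ≤ ‖x‖_∞`. [folklore] -/
theorem norm_coordFn_le (x : lp (fun _ : A => ℂ) ∞) (β : A) : ‖x β‖ ≤ ‖x‖ :=
  lp.norm_apply_le_norm ENNReal.top_ne_zero x β

/-! ## §2 Two facts about the disc automorphism `M_c(v) = (v − c)/(1 − c̄v)` -/

/-- `1 − c̄c = 1 − |c|²` as a complex number. [folklore] -/
theorem one_sub_conj_mul_self (c : ℂ) : (1 : ℂ) - conj c * c = ((1 - ‖c‖ ^ 2 : ℝ) : ℂ) := by
  rw [Complex.conj_mul']; push_cast; ring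

/-- The derivative of `M_c` at a point `v` of the disc: `(1 − c̄c)/(1 − c̄v)²`. [folklore] -/
theorem hasDerivAt_moebius {c v : ℂ} (hc : ‖c‖ < 1) (hv : ‖v‖ < 1) :
    HasDerivAt (moebius c) ((1 - conj c * c) / (1 - conj c * v) ^ 2) v := by
  have hden := denom_ne_zero hc hv
  have h1 : HasDerivAt (fun w : ℂ => w - c) 1 v := (hasDerivAt_id' v).sub_const c
  have h2 : HasDerivAt (fun w : ℂ => 1 - conj c * w) (-(conj c)) v := by
    simpa only [mul_one] using ((hasDerivAt_id' v).const_mul (conj c)).const_sub 1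
  have h := h1.div h2 hden
  have hfun : moebius c = fun w => (w - c) / (1 - conj c * w) := rfl
  rw [hfun]
  refine h.congr_deriv ?_
  rw [div_left_inj' (pow_ne_zero 2 hden)]
  ring

/-- QUANTITATIVE MÖBIUS BOUND: `|c| ≤ s < 1`, `|v| ≤ t < 1` ⇒ `|M_c(v)| ≤ 1 − (1−s²)(1−t²)/8` (from the identity
`|1 − c̄v|² − |v − c|² = (1−|c|²)(1−|v|²)` and `|1 − c̄v| ≤ 2`). [folklore] -/
theorem norm_moebius_le_sharp {c v : ℂ} {s t : ℝ} (hs1 : s < 1) (ht1 : t < 1) (hcs : ‖c‖ ≤ s) (hvt : ‖v‖ ≤ t) :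
    ‖moebius c v‖ ≤ 1 - (1 - s ^ 2) * (1 - t ^ 2) / 8 := by
  have hc0 := norm_nonneg c
  have hv0 := norm_nonneg v
  have hc : ‖c‖ < 1 := lt_of_le_of_lt hcs hs1
  have hv : ‖v‖ < 1 := lt_of_le_of_lt hvt ht1
  have hden := denom_ne_zero hc hv
  have hDpos : 0 < ‖1 - conj c * v‖ := norm_pos_iff.2 hden
  have hid : ‖1 - conj c * v‖ ^ 2 - ‖v - c‖ ^ 2 = (1 - ‖c‖ ^ 2) * (1 - ‖v‖ ^ 2) := normSq_identity c v
  have hD2 : ‖1 - conj c * v‖ ≤ 2 := by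
    calc ‖1 - conj c * v‖ ≤ ‖(1 : ℂ)‖ + ‖conj c * v‖ := norm_sub_le _ _
      _ = 1 + ‖c‖ * ‖v‖ := by rw [norm_one, norm_mul, Complex.norm_conj]
      _ ≤ 2 := by nlinarith
  have hs2 : ‖c‖ ^ 2 ≤ s ^ 2 := pow_le_pow_left₀ hc0 hcs 2
  have ht2 : ‖v‖ ^ 2 ≤ t ^ 2 := pow_le_pow_left₀ hv0 hvt 2
  set D := ‖1 - conj c * v‖ with hD
  set N := ‖v - c‖ with hN
  set δ := (1 - s ^ 2) * (1 - t ^ 2) with hδ_def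
  have hδ0 : 0 ≤ δ := mul_nonneg (by nlinarith) (by nlinarith)
  have hδ1 : δ ≤ 1 := by
    have h1 : 1 - s ^ 2 ≤ 1 := by nlinarith
    have h2 : 1 - t ^ 2 ≤ 1 := by nlinarith
    have h3 : 0 ≤ 1 - t ^ 2 := by nlinarith
    calc δ = (1 - s ^ 2) * (1 - t ^ 2) := hδ_def
      _ ≤ 1 * 1 := mul_le_mul h1 h2 h3 zero_le_one
      _ = 1 := one_mul 1
  have hδ : δ ≤ D ^ 2 - N ^ 2 := by
    rw [hid, hδ_def]
    exact mul_le_mul (by linarith) (by linarith) (by nlinarith) (by nlinarith)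
  have hN0 : 0 ≤ N := norm_nonneg _
  -- `N ≤ (1 − δ/8)·D`, via squares
  have hB0 : 0 ≤ (1 - δ / 8) * D := mul_nonneg (by linarith) hDpos.le
  have key : N ^ 2 ≤ ((1 - δ / 8) * D) ^ 2 := by
    have h4 : D ^ 2 ≤ 4 := by nlinarith
    nlinarith [mul_nonneg hδ0 (sub_nonneg.2 h4), mul_nonneg (mul_nonneg hδ0 hδ0) (sq_nonneg D)]
  have hle : N ≤ (1 - δ / 8) * D := le_of_pow_le_pow_left₀ two_ne_zero hB0 key
  rw [moebius, norm_div, div_le_iff₀ hDpos]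
  exact hle

/-! ## §3 The Möbius disc through a point of the unit ball of `ℓ^∞(A;ℂ)` -/

/-- `0 ≤ (1−a²)(1−b²) ≤ 1` for `a, b ∈ [0,1)`. [folklore] -/
theorem aux_delta {a b : ℝ} (ha0 : 0 ≤ a) (ha : a < 1) (hb0 : 0 ≤ b) (hb : b < 1) :
    0 < (1 - a ^ 2) * (1 - b ^ 2) ∧ (1 - a ^ 2) * (1 - b ^ 2) ≤ 1 := by
  have h1 : 0 < 1 - a ^ 2 := by nlinarith
  have h2 : 0 < 1 - b ^ 2 := by nlinarith
  exact ⟨mul_pos h1 h2, by nlinarith [mul_nonneg (sq_nonneg a) h2.le]⟩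

/-- Coordinate family of the MÖBIUS DISC through `x` with direction data `lam`:
`z ↦ M_{−x_α}(λ_α z) = (λ_α z + x_α)/(1 + x̄_α λ_α z)`. [folklore] -/
def discFam (x : lp (fun _ : A => ℂ) ∞) (lam : A → ℂ) : A → ℂ → ℂ := fun α z => moebius (-(x α)) (lam α * z)

/-- The Möbius disc as ONE `ℓ^∞(A;ℂ)`-valued map of `z` (the tree's `pack` of the coordinate family). [folklore] -/
def disc (x : lp (fun _ : A => ℂ) ∞) (lam : A → ℂ) : ℂ → lp (fun _ : A => ℂ) ∞ := pack (discFam x lam)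

section Disc

variable {x : lp (fun _ : A => ℂ) ∞} {lam : A → ℂ}

/-- `|−x_α| < 1` for `x` in the open unit ball. [folklore] -/
theorem norm_neg_coordFn_lt (hx : ‖x‖ < 1) (α : A) : ‖-(x α)‖ < 1 := by
  rw [norm_neg]; exact (norm_coordFn_le x α).trans_lt hx

/-- `|λ_α z| < 1` for `|λ_α| ≤ 1`, `|z| < 1`. [folklore] -/
theorem norm_mul_lt_one (hlam : ∀ α, ‖lam α‖ ≤ 1) {z : ℂ} (hz : ‖z‖ < 1) (α : A) : ‖lam α * z‖ < 1 := by
  rw [norm_mul]; exact (mul_le_of_le_one_left (norm_nonneg z) (hlam α)).trans_lt hz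

/-- Each coordinate of the disc has modulus `≤ 1` on the unit disc. [folklore] -/
theorem norm_discFam_le (hx : ‖x‖ < 1) (hlam : ∀ α, ‖lam α‖ ≤ 1) {z : ℂ} (hz : ‖z‖ < 1) (α : A) :
    ‖discFam x lam α z‖ ≤ 1 :=
  norm_moebius_le (norm_neg_coordFn_lt hx α) (norm_mul_lt_one hlam hz α)

/-- … and in fact `≤ 1 − (1−‖x‖²)(1−|z|²)/8`, UNIFORMLY in the coordinate. [folklore] -/
theorem norm_discFam_le_sharp (hx : ‖x‖ < 1) (hlam : ∀ α, ‖lam α‖ ≤ 1) {z : ℂ} (hz : ‖z‖ < 1) (α : A) :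
    ‖discFam x lam α z‖ ≤ 1 - (1 - ‖x‖ ^ 2) * (1 - ‖z‖ ^ 2) / 8 :=
  norm_moebius_le_sharp hx hz (by rw [norm_neg]; exact norm_coordFn_le x α)
    (by rw [norm_mul]; exact mul_le_of_le_one_left (norm_nonneg z) (hlam α))

/-- The coordinates of the disc. [folklore] -/
theorem disc_apply (hx : ‖x‖ < 1) (hlam : ∀ α, ‖lam α‖ ≤ 1) {z : ℂ} (hz : ‖z‖ < 1) (α : A) :
    disc x lam z α = moebius (-(x α)) (lam α * z) :=
  pack_apply_of_bound (M := 1) (fun i => norm_discFam_le hx hlam hz i) α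

/-- The disc maps the unit disc into the ball of radius `1 − (1−‖x‖²)(1−|z|²)/8 < 1`. [folklore] -/
theorem norm_disc_le (hx : ‖x‖ < 1) (hlam : ∀ α, ‖lam α‖ ≤ 1) {z : ℂ} (hz : ‖z‖ < 1) :
    ‖disc x lam z‖ ≤ 1 - (1 - ‖x‖ ^ 2) * (1 - ‖z‖ ^ 2) / 8 :=
  norm_pack_le_of_bound (by nlinarith [(aux_delta (norm_nonneg x) hx (norm_nonneg z) hz).2])
    (fun i => norm_discFam_le_sharp hx hlam hz i)

/-- The disc maps the open unit disc into the OPEN unit ball. [folklore] -/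
theorem mapsTo_disc (hx : ‖x‖ < 1) (hlam : ∀ α, ‖lam α‖ ≤ 1) :
    MapsTo (disc x lam) (ball (0 : ℂ) 1) (ball (0 : lp (fun _ : A => ℂ) ∞) 1) := by
  intro z hz
  rw [mem_ball_zero_iff] at hz ⊢
  have hδ := (aux_delta (norm_nonneg x) hx (norm_nonneg z) hz).1
  linarith [norm_disc_le hx hlam hz]

/-- Each coordinate of the disc is holomorphic on the unit disc. [folklore] -/
theorem differentiableOn_discFam (hx : ‖x‖ < 1) (hlam : ∀ α, ‖lam α‖ ≤ 1) (α : A) :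
    DifferentiableOn ℂ (discFam x lam α) (ball (0 : ℂ) 1) :=
  (differentiableOn_moebius (norm_neg_coordFn_lt hx α)).comp
    ((differentiable_id.const_mul (lam α)).differentiableOn)
    (fun _ hz => mem_ball_zero_iff.2 (norm_mul_lt_one hlam (mem_ball_zero_iff.1 hz) α))

/-- THE DISC IS HOLOMORPHIC as an `ℓ^∞(A;ℂ)`-valued map (the tree's `differentiableOn_pack`: uniformly bounded holomorphic
coordinates pack holomorphically). [folklore] -/
theorem differentiableOn_disc (hx : ‖x‖ < 1) (hlam : ∀ α, ‖lam α‖ ≤ 1) :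
    DifferentiableOn ℂ (disc x lam) (ball (0 : ℂ) 1) :=
  differentiableOn_pack (M := 1) isOpen_ball (fun α => differentiableOn_discFam hx hlam α)
    (fun α _ hz => norm_discFam_le hx hlam (mem_ball_zero_iff.1 hz) α)

/-- The disc passes through `x` at `z = 0`. [folklore] -/
theorem disc_zero (hx : ‖x‖ < 1) (hlam : ∀ α, ‖lam α‖ ≤ 1) : disc x lam 0 = x := by
  refine lp.ext (funext fun α => ?_)
  rw [disc_apply hx hlam (by simp) α]
  simp [moebius]

/-- The velocity of the `α`-th coordinate at `z = 0` is `(1 − |x_α|²)·λ_α`. [folklore] -/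
theorem hasDerivAt_discFam_zero (hx : ‖x‖ < 1) (α : A) :
    HasDerivAt (discFam x lam α) ((1 - conj (x α) * x α) * lam α) 0 := by
  have hc : ‖-(x α)‖ < 1 := norm_neg_coordFn_lt hx α
  have hm : HasDerivAt (moebius (-(x α)))
      ((1 - conj (-(x α)) * (-(x α))) / (1 - conj (-(x α)) * (lam α * 0)) ^ 2) (lam α * 0) :=
    hasDerivAt_moebius hc (by simp)
  have hl : HasDerivAt (fun z : ℂ => lam α * z) (lam α) 0 := by
    simpa only [mul_one] using (hasDerivAt_id' (0 : ℂ)).const_mul (lam α)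
  have h := hm.comp 0 hl
  refine h.congr_deriv ?_
  simp

/-- The velocity of the disc at `z = 0`, coordinatewise. [folklore] -/
theorem fderiv_disc_zero_apply (hx : ‖x‖ < 1) (hlam : ∀ α, ‖lam α‖ ≤ 1) (α : A) :
    (fderiv ℂ (disc x lam) 0 (1 : ℂ)) α = (1 - conj (x α) * x α) * lam α := by
  have h := hasFDerivAt_pack (f := discFam x lam) (x := (0 : ℂ)) one_pos zero_le_one
    (fun i => differentiableOn_discFam hx hlam i)
    (fun i w hw => norm_discFam_le hx hlam (mem_ball_zero_iff.1 hw) i)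
  rw [show disc x lam = pack (discFam x lam) from rfl, h.fderiv, packDeriv_apply]
  exact (hasDerivAt_discFam_zero hx α).deriv

/-- The disc has a derivative at `0` (as a map of one complex variable). [folklore] -/
theorem hasDerivAt_disc_zero (hx : ‖x‖ < 1) (hlam : ∀ α, ‖lam α‖ ≤ 1) :
    HasDerivAt (disc x lam) (fderiv ℂ (disc x lam) 0 1) 0 :=
  ((differentiableOn_disc hx hlam).differentiableAt (isOpen_ball.mem_nhds (by simp))).hasFDerivAt.hasDerivAt

end Disc

/-! ## §4 The infinitesimal polydisc Schwarz–Pick lemma -/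

/-- **INFINITESIMAL POLYDISC SCHWARZ–PICK.**  Let `f : B_{ℓ^∞(A)}(0,1) → B̄_𝔉(0,θ)` be holomorphic, `π : 𝔉 →L[ℂ] ℂ` a
functional with `‖π y‖ ≤ ‖y‖`, `0 ≤ θ < θ' ≤ 1`, `x ∈ B(0,1)`, and `v` with `|v_α| ≤ C·(1 − |x_α|²)` for all `α` (`C ≥ 0`).
Then `|π(Df(x)v)| ≤ θ'·C·(1 − |π(f x)|²)`.  Proof: Schwarz's lemma for `M_c ∘ (π ∘ f ∘ disc)/θ'`, `c = π(f x)/θ'`.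
[folklore; FV1980 (polydisc ∕ `ℓ^∞` ball: product property of the Carathéodory–Kobayashi metric)] -/
theorem norm_fderiv_apply_le {𝔉 : Type*} [NormedAddCommGroup 𝔉] [NormedSpace ℂ 𝔉] (π : 𝔉 →L[ℂ] ℂ)
    (hπ : ∀ y, ‖π y‖ ≤ ‖y‖) {θ θ' : ℝ} (hθ0 : 0 ≤ θ) (hθθ' : θ < θ') (hθ'1 : θ' ≤ 1)
    {f : lp (fun _ : A => ℂ) ∞ → 𝔉} (hf : DifferentiableOn ℂ f (ball 0 1))
    (hfm : MapsTo f (ball 0 1) (closedBall 0 θ)) {x : lp (fun _ : A => ℂ) ∞}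
    (hx : x ∈ ball (0 : lp (fun _ : A => ℂ) ∞) 1) (v : lp (fun _ : A => ℂ) ∞) {C : ℝ} (hC : 0 ≤ C)
    (hv : ∀ α, ‖v α‖ ≤ C * (1 - ‖x α‖ ^ 2)) :
    ‖π (fderiv ℂ f x v)‖ ≤ θ' * C * (1 - ‖π (f x)‖ ^ 2) := by
  have hθ' : 0 < θ' := lt_of_le_of_lt hθ0 hθθ'
  have hx1 : ‖x‖ < 1 := mem_ball_zero_iff.1 hx
  have ha : ‖π (f x)‖ ≤ θ := (hπ _).trans (mem_closedBall_zero_iff.1 (hfm hx))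
  rcases hC.eq_or_lt with hC0 | hCpos
  · -- `C = 0`: then `v = 0`
    have hv0 : v = 0 := by
      refine lp.ext (funext fun α => ?_)
      have h0 : ‖v α‖ ≤ 0 := by simpa [← hC0] using hv α
      simpa using h0
    rw [hv0, map_zero, map_zero, norm_zero, ← hC0]
    simp
  -- `C > 0`: the direction data of the disc
  have hw : ∀ α, 0 < 1 - ‖x α‖ ^ 2 := fun α => by
    have := (norm_coordFn_le x α).trans_lt hx1
    nlinarith [norm_nonneg (x α)]
  set lam : A → ℂ := fun α => v α / ((C * (1 - ‖x α‖ ^ 2) : ℝ) : ℂ) with hlam_def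
  have hlam : ∀ α, ‖lam α‖ ≤ 1 := fun α => by
    have hpos : 0 < C * (1 - ‖x α‖ ^ 2) := mul_pos hCpos (hw α)
    show ‖v α / ((C * (1 - ‖x α‖ ^ 2) : ℝ) : ℂ)‖ ≤ 1
    rw [norm_div, Complex.norm_of_nonneg hpos.le, div_le_one hpos]
    exact hv α
  -- the velocity of the disc at 0 is `C⁻¹ • v`
  have hC' : (C : ℂ) ≠ 0 := Complex.ofReal_ne_zero.2 hCpos.ne'
  have hderiv : fderiv ℂ (disc x lam) 0 1 = (C : ℂ)⁻¹ • v := by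
    refine lp.ext (funext fun α => ?_)
    have hw' : ((1 - ‖x α‖ ^ 2 : ℝ) : ℂ) ≠ 0 := Complex.ofReal_ne_zero.2 (hw α).ne'
    rw [fderiv_disc_zero_apply hx1 hlam α, lp.coeFn_smul, Pi.smul_apply, smul_eq_mul, one_sub_conj_mul_self]
    show ((1 - ‖x α‖ ^ 2 : ℝ) : ℂ) * (v α / ((C * (1 - ‖x α‖ ^ 2) : ℝ) : ℂ)) = (C : ℂ)⁻¹ * v α
    rw [Complex.ofReal_mul]
    field_simp
  -- the centre of the target Möbius map
  set a : ℂ := π (f x) with ha_def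
  set c : ℂ := a / (θ' : ℂ) with hc_def
  have hc : ‖c‖ < 1 := by
    rw [hc_def, norm_div, Complex.norm_of_nonneg hθ'.le, div_lt_one hθ']
    exact lt_of_le_of_lt ha hθθ'
  -- the inner function `π ∘ f ∘ disc / θ'`
  set inner : ℂ → ℂ := fun z => π (f (disc x lam z)) / (θ' : ℂ) with hinner_def
  have hin : ∀ z ∈ ball (0 : ℂ) 1, ‖inner z‖ < 1 := by
    intro z hz
    have hdz : disc x lam z ∈ ball (0 : lp (fun _ : A => ℂ) ∞) 1 := mapsTo_disc hx1 hlam hz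
    have h1 : ‖π (f (disc x lam z))‖ ≤ θ := (hπ _).trans (mem_closedBall_zero_iff.1 (hfm hdz))
    show ‖π (f (disc x lam z)) / (θ' : ℂ)‖ < 1
    rw [norm_div, Complex.norm_of_nonneg hθ'.le, div_lt_one hθ']
    exact lt_of_le_of_lt h1 hθθ'
  have hin0 : inner 0 = c := by
    show π (f (disc x lam 0)) / (θ' : ℂ) = π (f x) / (θ' : ℂ)
    rw [disc_zero hx1 hlam]
  have hind : DifferentiableOn ℂ inner (ball (0 : ℂ) 1) := by
    have h1 : DifferentiableOn ℂ (f ∘ disc x lam) (ball (0 : ℂ) 1) :=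
      hf.comp (differentiableOn_disc hx1 hlam) (mapsTo_disc hx1 hlam)
    have h2 : DifferentiableOn ℂ (fun z => π ((f ∘ disc x lam) z)) (ball (0 : ℂ) 1) :=
      π.differentiable.comp_differentiableOn h1
    exact h2.div_const (θ' : ℂ)
  -- the test function `g = M_c ∘ inner`
  set g : ℂ → ℂ := fun z => moebius c (inner z) with hg_def
  have hgd : DifferentiableOn ℂ g (ball (0 : ℂ) 1) :=
    (differentiableOn_moebius hc).comp hind fun z hz => mem_ball_zero_iff.2 (hin z hz)
  have hg0 : g 0 = 0 := by
    show moebius c (inner 0) = 0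
    rw [hin0, moebius_self]
  have hgm : MapsTo g (ball (0 : ℂ) 1) (closedBall (g 0) 1) := by
    intro z hz
    rw [hg0, mem_closedBall, dist_zero_right]
    exact norm_moebius_le hc (hin z hz)
  -- Schwarz's lemma for `g`
  have hS := Complex.norm_deriv_le_div_of_mapsTo_ball hgd hgm one_pos
  -- the derivative of `g` at `0`
  have hfx : HasFDerivAt f (fderiv ℂ f x) (disc x lam 0) := by
    rw [disc_zero hx1 hlam]
    exact (hf.differentiableAt (isOpen_ball.mem_nhds hx)).hasFDerivAt
  have hd1 : HasDerivAt (f ∘ disc x lam) (fderiv ℂ f x ((C : ℂ)⁻¹ • v)) 0 := by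
    have := hfx.comp_hasDerivAt (0 : ℂ) (hasDerivAt_disc_zero hx1 hlam)
    rw [hderiv] at this
    exact this
  have hd2 : HasDerivAt (fun z => π ((f ∘ disc x lam) z)) (π (fderiv ℂ f x ((C : ℂ)⁻¹ • v))) 0 :=
    π.hasFDerivAt.comp_hasDerivAt (0 : ℂ) hd1
  have hd3 : HasDerivAt inner (π (fderiv ℂ f x ((C : ℂ)⁻¹ • v)) / (θ' : ℂ)) 0 :=
    hd2.div_const (θ' : ℂ)
  have hmo : HasDerivAt (moebius c) ((1 - conj c * c) / (1 - conj c * c) ^ 2) (inner 0) := by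
    rw [hin0]; exact hasDerivAt_moebius hc hc
  have hd4 : HasDerivAt g
      ((1 - conj c * c) / (1 - conj c * c) ^ 2 * (π (fderiv ℂ f x ((C : ℂ)⁻¹ • v)) / (θ' : ℂ))) 0 :=
    hmo.comp 0 hd3
  rw [hd4.deriv, div_one] at hS
  -- unpack the norm
  have hρ : (1 : ℂ) - conj c * c = ((1 - ‖c‖ ^ 2 : ℝ) : ℂ) := one_sub_conj_mul_self c
  have hρpos : 0 < 1 - ‖c‖ ^ 2 := by nlinarith [norm_nonneg c]
  have hlin : π (fderiv ℂ f x ((C : ℂ)⁻¹ • v)) = (C : ℂ)⁻¹ * π (fderiv ℂ f x v) := by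
    rw [map_smul, map_smul, smul_eq_mul]
  rw [hρ, hlin] at hS
  have hρne := hρpos.ne'
  have hCne := hCpos.ne'
  have hθne := hθ'.ne'
  have hnorm : ‖((1 - ‖c‖ ^ 2 : ℝ) : ℂ) / ((1 - ‖c‖ ^ 2 : ℝ) : ℂ) ^ 2 *
        ((C : ℂ)⁻¹ * π (fderiv ℂ f x v) / (θ' : ℂ))‖
      = ‖π (fderiv ℂ f x v)‖ / ((1 - ‖c‖ ^ 2) * C * θ') := by
    simp only [norm_mul, norm_div, norm_inv, norm_pow, Complex.norm_of_nonneg hρpos.le,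
      Complex.norm_of_nonneg hCpos.le, Complex.norm_of_nonneg hθ'.le]
    field_simp
  rw [hnorm, div_le_one (mul_pos (mul_pos hρpos hCpos) hθ')] at hS
  -- `1 − |c|² = 1 − |a|²/θ'² ≤ 1 − |a|²` since `θ' ≤ 1`
  have hc2 : 1 - ‖c‖ ^ 2 ≤ 1 - ‖a‖ ^ 2 := by
    rw [hc_def, norm_div, Complex.norm_of_nonneg hθ'.le, div_pow]
    have hθ'2 : 0 < θ' ^ 2 := by positivity
    have : ‖a‖ ^ 2 ≤ ‖a‖ ^ 2 / θ' ^ 2 := by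
      rw [le_div_iff₀ hθ'2]
      have hθ'3 : θ' ^ 2 ≤ 1 := by nlinarith
      nlinarith [sq_nonneg ‖a‖]
    linarith
  calc ‖π (fderiv ℂ f x v)‖ ≤ (1 - ‖c‖ ^ 2) * C * θ' := hS
    _ ≤ (1 - ‖a‖ ^ 2) * C * θ' := mul_le_mul_of_nonneg_right (mul_le_mul_of_nonneg_right hc2 hCpos.le) hθ'.le
    _ = θ' * C * (1 - ‖a‖ ^ 2) := by ring

end Summit.QuantumFields.BalabanUV.T4Continuum.NE9PolydiscSchwarzPick

end
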